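import Summits.QuantumFields.BalabanUV.Beta.FP.NestedStepLawTorusTransportedRowsGradedGenSymULowClosedCompanion
import Summits.QuantumFields.BalabanUV.Beta.FP.NestedStepLawTorusTransportedRowsGradedLevelSuccSymULowClosedLam
import Summits.QuantumFields.BalabanUV.Beta.FP.PeriodisedSymCompositeIndexWardTwoPure
import Summits.QuantumFields.BalabanUV.Beta.FP.PeriodisedSymCoarseWardBiMember
import Summits.QuantumFields.BalabanUV.Beta.FP.PeriodisedSymBorderWardContactTwoInstance
import Summits.QuantumFields.BalabanUV.Beta.FP.PeriodisedSymDeadRowOrderTwo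

/-!
# `BalabanUV.Beta.FP.NestedStepLawTorusLevelSuccDoorCompanion` — road «FP» for binder row D1, ROUTE T, presentation T-β, option (δ) «LIFT ∕ GRADED»: **THE LEVEL-`(j+1)`
# STOREY OF THE (III′) LITERAL WITH THE R-FP-59 COMPANION PAIR** — the level-succ twin of `NestedStepLawTorusLevelZeroDoorCompanion` (leaf-02 g24 I-7): U22♭
# `…LevelSuccSymULowClosedLamQ2Pure` (♭ coarse bi-table; `q2 t2 c2 d2` BY TERM at level `j+1`) + (Δ1) the order-1 companion slot pair `(Λ₁ᴺ := Q₁₀ᵀ·Λ₁·Q₁₀,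
# Λ₁ᴳ := Λ₁)` and the order-2 coarse companion `Λ₂`, built on the companion call `…GradedGenSymULowClosedCompanion` (every level) at `j + 1` with U19's level-`(j+1)`
# bindings re-done on top (`hH₁ hH′₁`: an2's form-slot family (C) `+` Λ-sector (B); `k1 hH₁t` by an2's `torus_formSlot_indexLaw_bhKStepAt`,
# `torus_Lam_indexLaw_lamCoeffK_fine`, `torus_formSlot_family_transpose`, `torus_Lam_family_transpose_fine` — U19's blocks VERBATIM).

DISPLAYED after it: `Λ₁ Λ₂` (FREE coarse `(fields, fields)` matrices, graded parities `hΛ₁t hΛ₂t`), the graded Ward rows `a1 a2` FOR THE TOTAL JETS, `k2 hH₂t` (the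
level-`≥ 1` order-2 FORM slot — an2 PART THREE), `hdead`, `hfμ′ hcoarse′`, weights, namings + defining equations.  CONCLUSION: one-shot side at the total jets (order-1 slot
`H′₁ + Q₁₀ᵀΛ₁Q₁₀`, order-2 slot `H′₂ + (C + (PX − XᵀP) + (PX − XᵀP))`, forced by `k1 k2`) `=` nested side at the BARE jets `+` coarse side with `+ Λ₁ ∕ + Λ₂`.
Proof = ONE TERM of the companion call.  [folklore] composition BY NAME; no `def`, no `def … : Prop`, nothing cited, 0 sorry.  CANDIDATE presentation (♭) exactly
as U22♭ ∕ U23♭ (W-FP-25-4; the label «of record» waits for PART THREE, R-D1-g44-3); what `Λ₁ Λ₂` ARE is the dictionary's word — displayed, not asserted.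

HONEST DEPENDENCY (page 1, mandatory): continuum YM on T⁴ ⇐ BetaPertH ∧ nine spine estimates (0/9 proved); BetaPertH ⇐ (D1) ∧ (D4) ∧ CAP+tail;
G-an2-4 gates asym, D1 and NE2/3/4.  HONEST FRAMING (cell contract, verbatim): «discharging `BetaPertH` makes Bałaban's UV stability UNCONDITIONAL —
a real constructive-QFT result; it is NOT the continuum limit and NOT the Clay problem.»  ABSOLUTE RULE (cell charter, verbatim): «No internally-minted
statement may enter as a cited fact. Every hypothesis is either kernel-proved in this package or a verbatim quotation of a PUBLISHED theorem with page
reference. The manuscript(s) under audit are NOT citable for their own disputed steps — they are the thing under adjudication; programme-internal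
(2001/route/tribunal) claims are never citable.»  0 estimates; 0∕4 row-D1 binders; NOT (T-ID)∕(T-β) complete, NOT (J-a) complete, NOT SDF, NOT D1, NOT
BetaPertH, NOT continuum, NOT Clay.  Road «FP», D1 formalisation swarm leaf-02 (b2b-balaban-beta-d1-formalise-leaf-02) gen 24, 2026-08-23.  No existing file
touched.
-/

noncomputable section

open scoped BigOperators Matrix

namespace Summit.QuantumFields.BalabanUV.Beta.FP.NestedStepLawTorusLevelSuccDoorCompanion

open Matrix Finset
open Literature.Probability.LatticeModels (Torus.proj)
open Literature.MathematicalPhysics.QuantumFieldTheory.Balaban1983to89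
open Literature.MathematicalPhysics.QuantumFieldTheory.Balaban1983to89.Beta
open Literature.MathematicalPhysics.QuantumFieldTheory.Balaban1983to89.Beta.Composition (kkt)
open Literature.MathematicalPhysics.QuantumFieldTheory.Balaban1983to89.Beta.CompositionSingular (effForm flucCov minOp minOpL)
open Literature.MathematicalPhysics.QuantumFieldTheory.LatticeForm (quo)
open B5Prop11Plancherel (fine)
open B6Lemma24Torus (pbox mem_pbox)
open AffineAveraging (Site box toSite unitVec)
open AveragingContoursRooted (ctr ctrOff ctrOff_mem_box)
open SymAveragingHessianCounts (symVhSAt)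
open OneStepResolventKernel (Fib)
open Summit.QuantumFields.BalabanUV.Beta.BorderedHessian (bhKStepAt stepScale)
open Summit.QuantumFields.BalabanUV.Beta.DshAn1 (Dsh)
open Summit.QuantumFields.BalabanUV.Beta.SymShiftedSpread (bhKStepSh)
open Summit.QuantumFields.BalabanUV.Beta.D1BFx.LogDetSecondVariation (secondVar)
open Summit.QuantumFields.BalabanUV.Beta.FP.KernelPeriodisationFib (Idx perF)
open Summit.QuantumFields.BalabanUV.Beta.FP.KernelPeriodisationFibLoc (dper)
open Summit.QuantumFields.BalabanUV.Beta.FP.TorusGaugeCovariance (tdelta tgrad)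
open Summit.QuantumFields.BalabanUV.Beta.FP.TorusGaugeCovarianceCoarse (coarsePt tgradBlock)
open Summit.QuantumFields.BalabanUV.Beta.FP.TorusCombRows (Res combRowsT combBondT)
open Summit.QuantumFields.BalabanUV.Beta.FP.TorusCombNestedBasis (resBigEquiv)
open Summit.QuantumFields.BalabanUV.Beta.GAN24.FineReadoutCauchyFrame (toSite_mem_range)
open Summit.QuantumFields.BalabanUV.Beta.FP.NestedStepLawTorusTransportedRowsGradedGenSymULowClosedCompanion (secondVar_oneShot_nestedStepLaw_torus_transported_graded_rows_gen_sym_uLow_closed_companion)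
open Summit.QuantumFields.BalabanUV.Beta.FP.PeriodisedSymCompositeIndexWardTwoPure (torus_q2_sym_letter_pure)
open Summit.QuantumFields.BalabanUV.Beta.FP.PeriodisedSymCoarseWardBiMember (torus_d2_sym_bimember)
open Summit.QuantumFields.BalabanUV.Beta.FP.PeriodisedSymBorderWardContactTwoInstance (torus_c2_sym_weighted)
open Summit.QuantumFields.BalabanUV.Beta.FP.PeriodisedSymDeadRowOrderTwo (torus_t2_sym_of_average_dead)
open Summit.QuantumFields.BalabanUV.Beta.FP.NestedStepLawTorusTransportedRowsGradedSym (perF_bhKStepSh_Dsh_ff_eq_perF_bhKStepAt)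
open OneStepKernelFamily (KInvStep)
open InterLevelTransport (SLam)
open BalabanStepJetsSucc (wVH E2 lamCoeffK)
open Summit.QuantumFields.BalabanUV.Beta.SymAveragingHessianCounts (symHessFFAt)
open Summit.QuantumFields.BalabanUV.Beta.SpineRooted (e3OfK)
open Summit.QuantumFields.BalabanUV.Beta.CombChartStepJets (GcombSh JsB12CombSh0)
open Summit.QuantumFields.BalabanUV.Beta.SymSecondOrderTablesAn1 (symTablesAn1S2)
open Summit.QuantumFields.BalabanUV.Beta.CombLamSectorPeriodised (torus_Lam_indexLaw_lamCoeffK_fine torus_Lam_family_transpose_fine)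
open Summit.QuantumFields.BalabanUV.Beta.CombFormSlotPeriodised (torus_formSlot_indexLaw_bhKStepAt torus_formSlot_family_transpose)

open Summit.QuantumFields.BalabanUV.Beta.FP.NestedStepLawTorusTransportedRowsGradedGenSymULowClosed (secondVar_oneShot_nestedStepLaw_torus_transported_graded_rows_gen_sym_uLow_closed)
open Summit.QuantumFields.BalabanUV.Beta.SymSecondOrderTablesAn1 (symVh₂SAn1)
open ExpKernelCalculus (MKer)
variable (M' : Fin (3 + 1) → ℕ) [∀ μ, NeZero (M' μ)] {Lc : ℕ} [NeZero Lc]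

set_option synthInstance.maxSize 1024 in
/-- [folklore] **THE LEVEL-`(j+1)` STOREY WITH THE COMPANION PAIR** — U22♭'s binders VERBATIM plus the coarse companions `Λ₁ Λ₂` (graded parities) and the
graded Ward rows `a1 a2` for the TOTAL jets; `k1 hH₁t` (U19's blocks), `q2 t2 c2 d2` (I-3, leaf-06, T3, #35 at `j+1`) supplied inside; `k2 hH₂t` displayed.
Conclusion: U22♭'s with the one-shot slots at the total jets and the coarse words `+ Λ₁ ∕ + Λ₂`. -/
theorem secondVar_oneShot_nestedStepLaw_torus_levelSucc_door_companion (hM' : ∀ i, Lc ∣ M' i) (j : ℕ) (hLc : Odd Lc) (N : ℕ) (cΛ cB w : ℝ)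
    {κ : Type*} [Fintype κ] [DecidableEq κ] (pμ' : κ → ↥(pbox M')) (mμ' : κ → Fin (3 + 1))
    (hfμ' : Function.Injective (fun a : κ => ((pμ' a, Sum.inr (mμ' a)) : Idx M' (Fib 3))))
    (hcoarse' : ∀ (s : ↥(pbox M')) (m : Fin (3 + 1)),
      ((s, Sum.inr m) : Idx M' (Fib 3)) ∈ Set.range (fun a : κ => ((pμ' a, Sum.inr (mμ' a)) : Idx M' (Fib 3))) ↔ Torus.proj Lc (s : Site (3 + 1)) = 0)
    -- the torus objects of record, by defining equations
    {H₀ : Matrix (↥(pbox (fine Lc M')) × Fin (3 + 1)) (↥(pbox (fine Lc M')) × Fin (3 + 1)) ℝ}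
    {Q₁₀ : Matrix (↥(pbox M') × Fin (3 + 1)) (↥(pbox (fine Lc M')) × Fin (3 + 1)) ℝ}
    {τ₁ : Matrix (Res (ctr (3 + 1) Lc) Lc (fine Lc M')) (↥(pbox (fine Lc M')) × Fin (3 + 1)) ℝ}
    {τ₂ : Matrix (Res (ctr (3 + 1) Lc) Lc M') (↥(pbox M') × Fin (3 + 1)) ℝ}
    {D₁ : Matrix (↥(pbox (fine Lc M')) × Fin (3 + 1)) (Res (ctr (3 + 1) Lc) Lc (fine Lc M')) ℝ}
    {D₂ : Matrix (↥(pbox (fine Lc M')) × Fin (3 + 1)) (Res (ctr (3 + 1) Lc) Lc M') ℝ}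
    {Dbar : Matrix (↥(pbox M') × Fin (3 + 1)) (Res (ctr (3 + 1) Lc) Lc M') ℝ}
    {P : Matrix (Res (ctr (3 + 1) Lc) Lc M' ⊕ Res (ctr (3 + 1) Lc) Lc (fine Lc M')) (↥(pbox (fine Lc M')) × Fin (3 + 1)) ℝ}
    (hH₀ : H₀ = (perF (fine Lc M') (bhKStepSh 3 Lc (Dsh Lc) (j + 1))).submatrix
        (fun b : ↥(pbox (fine Lc M')) × Fin (3 + 1) => ((b.1, Sum.inl b.2) : Idx (fine Lc M') (Fib 3)))
        (fun b : ↥(pbox (fine Lc M')) × Fin (3 + 1) => ((b.1, Sum.inl b.2) : Idx (fine Lc M') (Fib 3))))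
    (hQ₁₀ : Q₁₀ = (perF (fine Lc M') (bhKStepSh 3 Lc (Dsh Lc) (j + 1))).submatrix
        (fun a : ↥(pbox M') × Fin (3 + 1) => ((coarsePt M' Lc a.1, Sum.inr a.2) : Idx (fine Lc M') (Fib 3)))
        (fun b : ↥(pbox (fine Lc M')) × Fin (3 + 1) => ((b.1, Sum.inl b.2) : Idx (fine Lc M') (Fib 3))))
    (hτ₁ : τ₁ = (combRowsT (ctr (3 + 1) Lc) Lc (fine Lc M')).submatrix id
        (fun b : ↥(pbox (fine Lc M')) × Fin (3 + 1) => ((b.1, Sum.inl b.2) : Idx (fine Lc M') (Fib 3))))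
    (hτ₂ : τ₂ = (combRowsT (ctr (3 + 1) Lc) Lc M').submatrix id (fun b : ↥(pbox M') × Fin (3 + 1) => ((b.1, Sum.inl b.2) : Idx M' (Fib 3))))
    (hD₁ : D₁ = (tgrad (fine Lc M')).submatrix (fun b : ↥(pbox (fine Lc M')) × Fin (3 + 1) => ((b.1, Sum.inl b.2) : Idx (fine Lc M') (Fib 3)))
        (Subtype.val : Res (ctr (3 + 1) Lc) Lc (fine Lc M') → ↥(pbox (fine Lc M'))))
    (hD₂ : D₂ = (tgradBlock M' Lc).submatrix (fun b : ↥(pbox (fine Lc M')) × Fin (3 + 1) => ((b.1, Sum.inl b.2) : Idx (fine Lc M') (Fib 3)))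
        (Subtype.val : Res (ctr (3 + 1) Lc) Lc M' → ↥(pbox M')))
    (hDbar : Dbar = Matrix.of fun (a : ↥(pbox M') × Fin (3 + 1)) (t : Res (ctr (3 + 1) Lc) Lc M') =>
        stepScale 3 Lc (j + 1) * (((box (3 + 1) Lc).card : ℝ) * tgrad M' (a.1, Sum.inl a.2) t.1))
    (hP : P = (combRowsT ((Lc : ℤ) • ctr (3 + 1) Lc + ctr (3 + 1) Lc) (Lc * Lc) (fine Lc M')).submatrix
        (resBigEquiv Lc Lc (ctr (3 + 1) Lc) (ctr (3 + 1) Lc) M' (Nat.pos_of_ne_zero (NeZero.ne Lc)) (toSite_mem_range (ctrOff_mem_box (Nat.one_le_iff_ne_zero.mpr (NeZero.ne Lc))))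
          (Nat.pos_of_ne_zero (NeZero.ne Lc)) (toSite_mem_range (ctrOff_mem_box (Nat.one_le_iff_ne_zero.mpr (NeZero.ne Lc))))).symm
        (fun b : ↥(pbox (fine Lc M')) × Fin (3 + 1) => ((b.1, Sum.inl b.2) : Idx (fine Lc M') (Fib 3))))
    -- the displayed jets: form, averaging (both levels), block covariance, generators (fine and coarse), Ward witnesses
    (H₂ : Matrix (↥(pbox (fine Lc M')) × Fin (3 + 1)) (↥(pbox (fine Lc M')) × Fin (3 + 1)) ℝ)
    {Q₂₀ : Matrix κ (↥(pbox M') × Fin (3 + 1)) ℝ}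
    (hQ₂₀ : Q₂₀ = (perF M' (bhKStepSh 3 Lc (Dsh Lc) ((j + 1) + 1))).submatrix (fun a : κ => ((pμ' a, Sum.inr (mμ' a)) : Idx M' (Fib 3)))
        (fun b : ↥(pbox M') × Fin (3 + 1) => ((b.1, Sum.inl b.2) : Idx M' (Fib 3))))
    -- leaf-02's ORDER-1 ROWS ALONG A DIRECTION `h` AND THE GAUGE PARAMETER `λ` OF THE CHART TRANSPORT: the insertion-table families (fine, and coarse
    -- transported by `θ_j·Q₁₀`), the generator jet and the coarse jet by their defining equations (p314580, `PeriodisedCoarseWardContact`, `NestedStepLawTorusInstanceRows`)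
    (h : ↥(pbox (fine Lc M')) × Fin (3 + 1) → ℝ) (lam : ↥(pbox (fine Lc M')) → ℝ)
    (Q₁₁ : (↥(pbox (fine Lc M')) × Fin (3 + 1) → ℝ) → Matrix (↥(pbox M') × Fin (3 + 1)) (↥(pbox (fine Lc M')) × Fin (3 + 1)) ℝ)
    (hQ₁₁ : ∀ w, Q₁₁ w = ∑ b : ↥(pbox (fine Lc M')) × Fin (3 + 1), w b •
        (perF (fine Lc M') (dper (fine Lc M') (symVhSAt (ctr (3 + 1) Lc) 3 Lc rfl b.2 (b.1 : Site (3 + 1))))).submatrix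
          (fun a : ↥(pbox M') × Fin (3 + 1) => ((coarsePt M' Lc a.1, Sum.inr a.2) : Idx (fine Lc M') (Fib 3)))
          (fun b : ↥(pbox (fine Lc M')) × Fin (3 + 1) => ((b.1, Sum.inl b.2) : Idx (fine Lc M') (Fib 3))))
    (Q₂₁ : (↥(pbox (fine Lc M')) × Fin (3 + 1) → ℝ) → Matrix κ (↥(pbox M') × Fin (3 + 1)) ℝ)
    (hQ₂₁ : ∀ w, Q₂₁ w = ∑ b : ↥(pbox (fine Lc M')) × Fin (3 + 1), w b •
        ∑ a' : ↥(pbox M') × Fin (3 + 1), (stepScale 3 Lc ((j + 1) + 1) / (stepScale 3 Lc (j + 1) ^ 2 * ((box (3 + 1) Lc).card : ℝ)) * Q₁₀ a' b) •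
          (perF M' (dper M' (symVhSAt (ctr (3 + 1) Lc) 3 Lc rfl a'.2 (a'.1 : Site (3 + 1))))).submatrix (fun a : κ => ((pμ' a, Sum.inr (mμ' a)) : Idx M' (Fib 3)))
            (fun b : ↥(pbox M') × Fin (3 + 1) => ((b.1, Sum.inl b.2) : Idx M' (Fib 3))))
    {W₁ : Matrix (↥(pbox (fine Lc M')) × Fin (3 + 1)) (Res (ctr (3 + 1) Lc) Lc M' ⊕ Res (ctr (3 + 1) Lc) Lc (fine Lc M')) ℝ}
    (hW₁ : W₁ = ∑ b : ↥(pbox (fine Lc M')) × Fin (3 + 1), h b •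
        Matrix.of (fun (b' : ↥(pbox (fine Lc M')) × Fin (3 + 1)) (e : Res (ctr (3 + 1) Lc) Lc M' ⊕ Res (ctr (3 + 1) Lc) Lc (fine Lc M')) =>
          if b' = b then
            -((((Lc : ℝ) ^ (3 + 1) * stepScale 3 Lc (j + 1))⁻¹)
              * Sum.elim (fun t : Res (ctr (3 + 1) Lc) Lc M' => tdelta M' (quo Lc ((b.1 : Site (3 + 1)) + unitVec b.2)) t.1)
                  (fun s : Res (ctr (3 + 1) Lc) Lc (fine Lc M') => tdelta (fine Lc M') ((b.1 : Site (3 + 1)) + unitVec b.2) s.1) e)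
          else 0))
    {Db₁ : Matrix (↥(pbox M') × Fin (3 + 1)) (Res (ctr (3 + 1) Lc) Lc M') ℝ}
    (hDb₁ : Db₁ = ∑ b : ↥(pbox (fine Lc M')) × Fin (3 + 1), h b •
        Matrix.of fun (a : ↥(pbox M') × Fin (3 + 1)) (t : Res (ctr (3 + 1) Lc) Lc M') =>
          -((((Lc : ℝ) ^ (3 + 1) * stepScale 3 Lc (j + 1))⁻¹) * Q₁₀ a b * tdelta M' ((a.1 : Site (3 + 1)) + unitVec a.2) t.1))
    -- LEVEL j+1: the first-order FORM jet along `h` IS `wT •` an2's periodised FORM-SLOT family `T_{j+1}` ((C) `CombFormSlotPeriodised`) `+ w •` an2's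
    -- level-(j+1) periodised Λ-SECTOR family ((B) `CombLamSectorPeriodised`), `wT := −2·c_{j+1}·wVH 3 Lc (j+1)` forced by the pin `hX`, `w` DISPLAYED (binding displayed, not asserted)
    {H₁ : Matrix (↥(pbox (fine Lc M')) × Fin (3 + 1)) (↥(pbox (fine Lc M')) × Fin (3 + 1)) ℝ}
    (hH₁ : H₁ = (∑ b : ↥(pbox (fine Lc M')) × Fin (3 + 1), h b •
        ((-2 * (((Lc : ℝ) ^ (3 + 1) * stepScale 3 Lc (j + 1))⁻¹) * wVH 3 Lc (j + 1)) • (perF (fine Lc M') (dper (fine Lc M')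
            (e3OfK Lc (GcombSh (d := 3) Lc j) (JsB12CombSh0 hLc N (symTablesAn1S2 3 Lc cΛ) cΛ cB j).S b.2 (b.1 : Site 4)))).submatrix
          (fun b : ↥(pbox (fine Lc M')) × Fin (3 + 1) => ((b.1, Sum.inl b.2) : Idx (fine Lc M') (Fib 3)))
          (fun b : ↥(pbox (fine Lc M')) × Fin (3 + 1) => ((b.1, Sum.inl b.2) : Idx (fine Lc M') (Fib 3)))))
      + ∑ b : ↥(pbox (fine Lc M')) × Fin (3 + 1), h b •
        (w • (perF (fine Lc M') (dper (fine Lc M')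
            (SLam Lc (lamCoeffK (KInvStep (d := 3) Lc (j + 1)) (E2 3 Lc (j + 1)) Lc) (symHessFFAt (ctr (3 + 1) Lc) Lc) b.2 (b.1 : Site (3 + 1))))).submatrix
          (fun b : ↥(pbox (fine Lc M')) × Fin (3 + 1) => ((b.1, Sum.inl b.2) : Idx (fine Lc M') (Fib 3)))
          (fun b : ↥(pbox (fine Lc M')) × Fin (3 + 1) => ((b.1, Sum.inl b.2) : Idx (fine Lc M') (Fib 3)))))
    -- the NESTED chart's direction is average-coarse-comb-dead (the hypothesis of `torus_t1_of_average_dead`)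
    (hdead : ∀ (a : ↥(pbox M') × Fin (3 + 1)) (x : Res (ctr (3 + 1) Lc) Lc M'),
      combBondT (ctr (3 + 1) Lc) Lc M' x = ((a.1, Sum.inl a.2) : Idx M' (Fib 3)) → ∑ b : ↥(pbox (fine Lc M')) × Fin (3 + 1), Q₁₀ a b * h b = 0)
    -- the second-order data stay displayed
    -- ORDER 2 ON THE AVERAGING SIDE, BOUND — branch (♭) of FINDING F-leaf02-g24-2 one level up: `Q₁₂ w w′ := −c_{j+1} • ΣΣ (w b·w′ b′) •` the
    -- second-bond-periodised border bi-member of `symVh₂SAn1 3 Lc` on `F` (U22's VERBATIM), `Q₂₂ w w′ := −c_{j+2} • ΣΣ (w̄ a′·w̄′ a″) •` the same on `M′` along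
    -- `w̄ = θ_{j+1}•Q₁₀ w` ALONE (NO average-map second-jet member) — displayed defining equations
    {W₁₂ : Fin (3 + 1) → Site (3 + 1) → Fin (3 + 1) → Site (3 + 1) → MKer (3 + 1) (Fib 3)}
    (hW₁₂ : W₁₂ = fun κ' u' κ u x z a c => ∑' n : Site (3 + 1), symVh₂SAn1 3 Lc κ u κ' (B4TorusKernel.MultiPeriod.translate (fine Lc M') u' n) x z a c)
    (Q₁₂ : (↥(pbox (fine Lc M')) × Fin (3 + 1) → ℝ) → (↥(pbox (fine Lc M')) × Fin (3 + 1) → ℝ) → Matrix (↥(pbox M') × Fin (3 + 1)) (↥(pbox (fine Lc M')) × Fin (3 + 1)) ℝ)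
    (hQ₁₂ : ∀ w w', Q₁₂ w w' = -(((Lc : ℝ) ^ (3 + 1) * stepScale 3 Lc (j + 1))⁻¹) • ∑ b : ↥(pbox (fine Lc M')) × Fin (3 + 1), ∑ b' : ↥(pbox (fine Lc M')) × Fin (3 + 1), (w b * w' b') •
        (perF (fine Lc M') (dper (fine Lc M') (W₁₂ b'.2 (b'.1 : Site (3 + 1)) b.2 (b.1 : Site (3 + 1))))).submatrix
          (fun a : ↥(pbox M') × Fin (3 + 1) => ((coarsePt M' Lc a.1, Sum.inr a.2) : Idx (fine Lc M') (Fib 3)))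
          (fun c : ↥(pbox (fine Lc M')) × Fin (3 + 1) => ((c.1, Sum.inl c.2) : Idx (fine Lc M') (Fib 3))))
    {W₂₂ : Fin (3 + 1) → Site (3 + 1) → Fin (3 + 1) → Site (3 + 1) → MKer (3 + 1) (Fib 3)}
    (hW₂₂ : W₂₂ = fun κ' u' κ u x z a c => ∑' n : Site (3 + 1), symVh₂SAn1 3 Lc κ u κ' (B4TorusKernel.MultiPeriod.translate M' u' n) x z a c)
    (Q₂₂ : (↥(pbox (fine Lc M')) × Fin (3 + 1) → ℝ) → (↥(pbox (fine Lc M')) × Fin (3 + 1) → ℝ) → Matrix κ (↥(pbox M') × Fin (3 + 1)) ℝ)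
    (hQ₂₂ : ∀ w w', Q₂₂ w w' = -(((Lc : ℝ) ^ (3 + 1) * stepScale 3 Lc ((j + 1) + 1))⁻¹) • (∑ a' : ↥(pbox M') × Fin (3 + 1), ∑ a'' : ↥(pbox M') × Fin (3 + 1),
          (((stepScale 3 Lc ((j + 1) + 1) / (stepScale 3 Lc (j + 1) ^ 2 * ((box (3 + 1) Lc).card : ℝ))) * ∑ b : ↥(pbox (fine Lc M')) × Fin (3 + 1), Q₁₀ a' b * w b) * ((stepScale 3 Lc ((j + 1) + 1) / (stepScale 3 Lc (j + 1) ^ 2 * ((box (3 + 1) Lc).card : ℝ))) * ∑ b : ↥(pbox (fine Lc M')) × Fin (3 + 1), Q₁₀ a'' b * w' b)) •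
            (perF M' (dper M' (W₂₂ a''.2 (a''.1 : Site (3 + 1)) a'.2 (a'.1 : Site (3 + 1))))).submatrix (fun a : κ => ((pμ' a, Sum.inr (mμ' a)) : Idx M' (Fib 3)))
            (fun b : ↥(pbox M') × Fin (3 + 1) => ((b.1, Sum.inl b.2) : Idx M' (Fib 3)))))
    -- leaf-06's EXPONENTIAL closed form of the nested chart's generator SECOND jet along `h` (`TorusGeneratorIntertwiningTwo.torus_j2`'s `hW₂`)
    {W₂ : Matrix (↥(pbox (fine Lc M')) × Fin (3 + 1)) (Res (ctr (3 + 1) Lc) Lc M' ⊕ Res (ctr (3 + 1) Lc) Lc (fine Lc M')) ℝ}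
    (hW₂ : W₂ = Matrix.of fun (b : ↥(pbox (fine Lc M')) × Fin (3 + 1)) (e : Res (ctr (3 + 1) Lc) Lc M' ⊕ Res (ctr (3 + 1) Lc) Lc (fine Lc M')) =>
        ((((Lc : ℝ) ^ (3 + 1) * stepScale 3 Lc (j + 1))⁻¹) * h b) ^ 2 * Sum.elim (fun t : Res (ctr (3 + 1) Lc) Lc M' => tdelta M' (quo Lc ((b.1 : Site (3 + 1)) + unitVec b.2)) t.1)
          (fun s : Res (ctr (3 + 1) Lc) Lc (fine Lc M') => tdelta (fine Lc M') ((b.1 : Site (3 + 1)) + unitVec b.2) s.1) e)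
    (Y₁ Y₂ : Matrix κ (Res (ctr (3 + 1) Lc) Lc M' ⊕ Res (ctr (3 + 1) Lc) Lc (fine Lc M')) ℝ)
    -- the chart transport (exponential currency): generators `X` (fields), `X̄` (composite multipliers); the one-shot chart's generator jets `W♯₁ W♯₂`;
    -- the parameter-transport jets `C₁ C₂`
    {X : Matrix (↥(pbox (fine Lc M')) × Fin (3 + 1)) (↥(pbox (fine Lc M')) × Fin (3 + 1)) ℝ} {Xbar : Matrix κ κ ℝ}
    -- (T-β-1) at the torus: the transport generators ARE the diagonal gauge generators of the parameter `λ` (fields: `−c•E_λ`; composite multipliers: `c•R′_λ̄`)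
    (hX : X = -((((Lc : ℝ) ^ (3 + 1) * stepScale 3 Lc (j + 1))⁻¹) • Matrix.diagonal (fun b : ↥(pbox (fine Lc M')) × Fin (3 + 1) => lam b.1)))
    (hXbar : Xbar = (((Lc : ℝ) ^ (3 + 1) * stepScale 3 Lc (j + 1))⁻¹) •
        Matrix.diagonal (fun α : κ => ∑ t : ↥(pbox M'), tdelta M' ((pμ' α : Site (3 + 1)) + ctr (3 + 1) Lc) t
          * (∑ s : ↥(pbox (fine Lc M')), tdelta (fine Lc M') ((Lc : ℤ) • (t : Site (3 + 1)) + ctr (3 + 1) Lc) s * lam s)))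
    -- (T-β-4) AT THE TORUS (leaf-06 `TorusGeneratorIntertwining`): the one-shot chart's generator first jet IS the nested chart's generator jet ALONG THE
    -- GAUGE-SHIFTED DIRECTION `h + Dλ`, by its defining equation in closed form (`weightedJet_eq` currency)
    {W'₁ : Matrix (↥(pbox (fine Lc M')) × Fin (3 + 1)) (Res (ctr (3 + 1) Lc) Lc M' ⊕ Res (ctr (3 + 1) Lc) Lc (fine Lc M')) ℝ}
    (hW'₁ : W'₁ = Matrix.of fun (b : ↥(pbox (fine Lc M')) × Fin (3 + 1)) (e : Res (ctr (3 + 1) Lc) Lc M' ⊕ Res (ctr (3 + 1) Lc) Lc (fine Lc M')) =>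
        -((((Lc : ℝ) ^ (3 + 1) * stepScale 3 Lc (j + 1))⁻¹) * (h b + ∑ s, tgrad (fine Lc M') (b.1, Sum.inl b.2) s * lam s)
          * Sum.elim (fun t : Res (ctr (3 + 1) Lc) Lc M' => tdelta M' (quo Lc ((b.1 : Site (3 + 1)) + unitVec b.2)) t.1)
            (fun s : Res (ctr (3 + 1) Lc) Lc (fine Lc M') => tdelta (fine Lc M') ((b.1 : Site (3 + 1)) + unitVec b.2) s.1) e))
    -- the one-shot chart's generator SECOND jet along `h + Dλ`, exponential closed form (`torus_j2`'s `hW₂'`, `torus_uP_exp`'s `hW₂` at `w := h + Dλ`)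
    {W'₂ : Matrix (↥(pbox (fine Lc M')) × Fin (3 + 1)) (Res (ctr (3 + 1) Lc) Lc M' ⊕ Res (ctr (3 + 1) Lc) Lc (fine Lc M')) ℝ}
    (hW'₂ : W'₂ = Matrix.of fun (b : ↥(pbox (fine Lc M')) × Fin (3 + 1)) (e : Res (ctr (3 + 1) Lc) Lc M' ⊕ Res (ctr (3 + 1) Lc) Lc (fine Lc M')) =>
        ((((Lc : ℝ) ^ (3 + 1) * stepScale 3 Lc (j + 1))⁻¹) * (h b + ∑ s, tgrad (fine Lc M') (b.1, Sum.inl b.2) s * lam s)) ^ 2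
          * Sum.elim (fun t : Res (ctr (3 + 1) Lc) Lc M' => tdelta M' (quo Lc ((b.1 : Site (3 + 1)) + unitVec b.2)) t.1)
            (fun s : Res (ctr (3 + 1) Lc) Lc (fine Lc M') => tdelta (fine Lc M') ((b.1 : Site (3 + 1)) + unitVec b.2) s.1) e)
    -- the parameter-transport GENERATOR `C₁(λ)` by leaf-06's defining equation `hC₁` VERBATIM («multiplication by `λ` in the gauge-mode basis»: `diagonal λ̄`
    -- on the coarse residual parameters, `diagonal (λ∘val)` on the fine ones, coarse-to-fine block `(λ s − λ̄ t)·[block s = t]`); the transport is `c • C₁`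
    {C₁ : Matrix (Res (ctr (3 + 1) Lc) Lc M' ⊕ Res (ctr (3 + 1) Lc) Lc (fine Lc M')) (Res (ctr (3 + 1) Lc) Lc M' ⊕ Res (ctr (3 + 1) Lc) Lc (fine Lc M')) ℝ}
    (hC₁ : C₁ = Matrix.fromBlocks
        (Matrix.diagonal fun t : Res (ctr (3 + 1) Lc) Lc M' =>
          ∑ s, tdelta (fine Lc M') ((Lc : ℤ) • ((t.1 : ↥(pbox M')) : Site (3 + 1)) + ctr (3 + 1) Lc) s * lam s)
        (0 : Matrix (Res (ctr (3 + 1) Lc) Lc M') (Res (ctr (3 + 1) Lc) Lc (fine Lc M')) ℝ)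
        (Matrix.of fun (s : Res (ctr (3 + 1) Lc) Lc (fine Lc M')) (t : Res (ctr (3 + 1) Lc) Lc M') =>
          (lam s.1 - ∑ s', tdelta (fine Lc M') ((Lc : ℤ) • ((t.1 : ↥(pbox M')) : Site (3 + 1)) + ctr (3 + 1) Lc) s' * lam s')
            * tdelta M' (quo Lc ((s.1 : ↥(pbox (fine Lc M'))) : Site (3 + 1))) t.1)
        (Matrix.diagonal fun s : Res (ctr (3 + 1) Lc) Lc (fine Lc M') => lam s.1))
    {𝔔₀ 𝔔₁ 𝔔₂ : Matrix κ (↥(pbox (fine Lc M')) × Fin (3 + 1)) ℝ}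
    (h𝔔₀ : Q₂₀ * Q₁₀ = 𝔔₀) (h𝔔₁ : Q₂₁ h * Q₁₀ + Q₂₀ * Q₁₁ h = 𝔔₁)
    (h𝔔₂ : Q₂₂ h h * Q₁₀ + Q₂₁ h * Q₁₁ h + (Q₂₁ h * Q₁₁ h + Q₂₀ * Q₁₂ h h) = 𝔔₂)
    -- (T-β-1) GRADED: the ONE-SHOT literal's composite jets are the graded `X`-conjugated words of the nested-chart jets (`𝔎 = H`: δ-constrained), NAMED
    {H'₂ : Matrix (↥(pbox (fine Lc M')) × Fin (3 + 1)) (↥(pbox (fine Lc M')) × Fin (3 + 1)) ℝ}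
    -- LEVEL j+1: the ONE-SHOT literal's first form jet IS the same two families along the GAUGE-SHIFTED direction `h + Dλ` (`k1` DISCHARGED)
    {H'₁ : Matrix (↥(pbox (fine Lc M')) × Fin (3 + 1)) (↥(pbox (fine Lc M')) × Fin (3 + 1)) ℝ}
    (hH'₁ : H'₁ = (∑ b : ↥(pbox (fine Lc M')) × Fin (3 + 1), (h b + ∑ s : ↥(pbox (fine Lc M')), tgrad (fine Lc M') (b.1, Sum.inl b.2) s * lam s) •
        ((-2 * (((Lc : ℝ) ^ (3 + 1) * stepScale 3 Lc (j + 1))⁻¹) * wVH 3 Lc (j + 1)) • (perF (fine Lc M') (dper (fine Lc M')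
            (e3OfK Lc (GcombSh (d := 3) Lc j) (JsB12CombSh0 hLc N (symTablesAn1S2 3 Lc cΛ) cΛ cB j).S b.2 (b.1 : Site 4)))).submatrix
          (fun b : ↥(pbox (fine Lc M')) × Fin (3 + 1) => ((b.1, Sum.inl b.2) : Idx (fine Lc M') (Fib 3)))
          (fun b : ↥(pbox (fine Lc M')) × Fin (3 + 1) => ((b.1, Sum.inl b.2) : Idx (fine Lc M') (Fib 3)))))
      + ∑ b : ↥(pbox (fine Lc M')) × Fin (3 + 1), (h b + ∑ s : ↥(pbox (fine Lc M')), tgrad (fine Lc M') (b.1, Sum.inl b.2) s * lam s) •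
        (w • (perF (fine Lc M') (dper (fine Lc M')
            (SLam Lc (lamCoeffK (KInvStep (d := 3) Lc (j + 1)) (E2 3 Lc (j + 1)) Lc) (symHessFFAt (ctr (3 + 1) Lc) Lc) b.2 (b.1 : Site (3 + 1))))).submatrix
          (fun b : ↥(pbox (fine Lc M')) × Fin (3 + 1) => ((b.1, Sum.inl b.2) : Idx (fine Lc M') (Fib 3)))
          (fun b : ↥(pbox (fine Lc M')) × Fin (3 + 1) => ((b.1, Sum.inl b.2) : Idx (fine Lc M') (Fib 3)))))
    {𝔔'₁ 𝔔'₂ : Matrix κ (↥(pbox (fine Lc M')) × Fin (3 + 1)) ℝ}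
    -- `q1` DISCHARGED (`PeriodisedCompositeIndexWard.torus_q1_letter`): the one-shot literal's first composite averaging jet IS the composite insertion jet
    -- along the GAUGE-SHIFTED direction `h + Dλ`, NAMED
    (h𝔔'₁ : Q₂₁ (fun b => h b + ∑ s : ↥(pbox (fine Lc M')), tgrad (fine Lc M') (b.1, Sum.inl b.2) s * lam s) * Q₁₀
        + Q₂₀ * Q₁₁ (fun b => h b + ∑ s : ↥(pbox (fine Lc M')), tgrad (fine Lc M') (b.1, Sum.inl b.2) s * lam s) = 𝔔'₁)
    (k2 : (X * X)ᵀ * H₀ + (-(Xᵀ * H₁) + -(Xᵀ * H₀ * X)) + ((-(Xᵀ * H₁) + -(Xᵀ * H₀ * X)) + (H₂ + H₁ * X + (H₁ * X + H₀ * (X * X)))) = H'₂)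
    -- `q2` DISCHARGED (`PeriodisedSymCompositeIndexWardTwoPure.torus_q2_sym_letter_pure` at level `j+1`): the one-shot literal's SECOND composite averaging jet
    -- NAMED — the composite 2-jet ALONG `h′ = h + Dλ` EXACTLY (NO un-shifted rider)
    (h𝔔'₂ : Q₂₂ (fun b => h b + ∑ s : ↥(pbox (fine Lc M')), tgrad (fine Lc M') (b.1, Sum.inl b.2) s * lam s) (fun b => h b + ∑ s : ↥(pbox (fine Lc M')), tgrad (fine Lc M') (b.1, Sum.inl b.2) s * lam s) * Q₁₀
        + Q₂₁ (fun b => h b + ∑ s : ↥(pbox (fine Lc M')), tgrad (fine Lc M') (b.1, Sum.inl b.2) s * lam s) * Q₁₁ (fun b => h b + ∑ s : ↥(pbox (fine Lc M')), tgrad (fine Lc M') (b.1, Sum.inl b.2) s * lam s)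
        + (Q₂₁ (fun b => h b + ∑ s : ↥(pbox (fine Lc M')), tgrad (fine Lc M') (b.1, Sum.inl b.2) s * lam s) * Q₁₁ (fun b => h b + ∑ s : ↥(pbox (fine Lc M')), tgrad (fine Lc M') (b.1, Sum.inl b.2) s * lam s)
          + Q₂₀ * Q₁₂ (fun b => h b + ∑ s : ↥(pbox (fine Lc M')), tgrad (fine Lc M') (b.1, Sum.inl b.2) s * lam s) (fun b => h b + ∑ s : ↥(pbox (fine Lc M')), tgrad (fine Lc M') (b.1, Sum.inl b.2) s * lam s)) = 𝔔'₂)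
    -- `j1 j2 uC uP' uLow t1` DISCHARGED below this layer; `t2` DISCHARGED (leaf-06 g25 `torus_t2_sym_of_average_dead` at `j+1` ⟸ `hdead`)
    -- the parities of the displayed form jets (`H₀ᵀ = H₀` is a theorem, discharged inside the graded call: `PeriodisedWardOrderZero.torus_H₀_transpose`)
    -- the parity of the displayed SECOND-order form jet (`hH₁t` is DISCHARGED: an2 (C) §4 `torus_formSlot_family_transpose` + (B) `torus_Lam_family_transpose_fine`)
    (hH₂t : H₂ᵀ = H₂)
    -- the R-FP-59 COMPANIONS on the coarse `(fields, fields)` block (W-FP-24-3 (Δ1); an2 PART THREE at order 2): FREE, graded parities displayed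
    (Λ₁ Λ₂ : Matrix (↥(pbox M') × Fin (3 + 1)) (↥(pbox M') × Fin (3 + 1)) ℝ) (hΛ₁t : Λ₁ᵀ = -Λ₁) (hΛ₂t : Λ₂ᵀ = Λ₂)
    -- the GRADED Ward rows FOR THE TOTAL JETS `𝔎₁ = H₁ + Q₁₀ᵀΛ₁Q₁₀`, `𝔎₂ = H₂ + C` ((Δ2) pattern one level up); read at `Y₀ = 0`
    (a1 : (H₁ + (Q₁₀ᵀ * Λ₁ * Q₁₀)) * fromCols D₂ D₁ + H₀ * W₁ = 𝔔₀ᵀ * Y₁)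
    (a2 : (H₂ + (-((Q₁₁ h)ᵀ * Λ₁ * Q₁₀) - (Q₁₁ h)ᵀ * Λ₁ * Q₁₀ + Q₁₀ᵀ * Λ₂ * Q₁₀ + Q₁₀ᵀ * Λ₁ * Q₁₁ h + Q₁₀ᵀ * Λ₁ * Q₁₁ h)) * fromCols D₂ D₁ + (2 : ℝ) • ((H₁ + (Q₁₀ᵀ * Λ₁ * Q₁₀)) * W₁) + H₀ * W₂
      = -((2 : ℝ) • (𝔔₁ᵀ * Y₁)) + 𝔔₀ᵀ * Y₂)
    -- the insertion-table covariance rows `c0 c1 c2` and the coarse covariance rows `d0 d1 d2` are ALL DISCHARGED (p316503, p314580, T3, #35) at level `j+1`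
    -- block namings and the coarse non-degeneracy
    {Γ : Matrix (↥(pbox (fine Lc M')) × Fin (3 + 1)) (↥(pbox (fine Lc M')) × Fin (3 + 1)) ℝ}
    {I : Matrix (↥(pbox (fine Lc M')) × Fin (3 + 1)) ((↥(pbox M') × Fin (3 + 1)) ⊕ Res (ctr (3 + 1) Lc) Lc (fine Lc M')) ℝ}
    {L : Matrix ((↥(pbox M') × Fin (3 + 1)) ⊕ Res (ctr (3 + 1) Lc) Lc (fine Lc M')) (↥(pbox (fine Lc M')) × Fin (3 + 1)) ℝ}
    {S : Matrix ((↥(pbox M') × Fin (3 + 1)) ⊕ Res (ctr (3 + 1) Lc) Lc (fine Lc M')) ((↥(pbox M') × Fin (3 + 1)) ⊕ Res (ctr (3 + 1) Lc) Lc (fine Lc M')) ℝ}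
    {B : Matrix ((↥(pbox M') × Fin (3 + 1)) ⊕ Res (ctr (3 + 1) Lc) Lc (fine Lc M')) (↥(pbox (fine Lc M')) × Fin (3 + 1)) ℝ}
    (hΓ : flucCov H₀ (fromRows Q₁₀ τ₁) = Γ) (hI : minOp H₀ (fromRows Q₁₀ τ₁) = I) (hL : minOpL H₀ (fromRows Q₁₀ τ₁) = L) (hS : effForm H₀ (fromRows Q₁₀ τ₁) = S)
    (hB : fromRows (Q₁₁ h) (0 : Matrix (Res (ctr (3 + 1) Lc) Lc (fine Lc M')) (↥(pbox (fine Lc M')) × Fin (3 + 1)) ℝ) = B) :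
    secondVar (kkt H₀ (fromRows 𝔔₀ P))
        (fromBlocks (H'₁ + (Q₁₀ᵀ * Λ₁ * Q₁₀)) (-(fromRows 𝔔'₁ (0 : Matrix (Res (ctr (3 + 1) Lc) Lc M' ⊕ Res (ctr (3 + 1) Lc) Lc (fine Lc M')) (↥(pbox (fine Lc M')) × Fin (3 + 1)) ℝ))ᵀ)
          (fromRows 𝔔'₁ (0 : Matrix (Res (ctr (3 + 1) Lc) Lc M' ⊕ Res (ctr (3 + 1) Lc) Lc (fine Lc M')) (↥(pbox (fine Lc M')) × Fin (3 + 1)) ℝ)) 0)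
        (kkt (H'₂ + ((-((Q₁₁ h)ᵀ * Λ₁ * Q₁₀) - (Q₁₁ h)ᵀ * Λ₁ * Q₁₀ + Q₁₀ᵀ * Λ₂ * Q₁₀ + Q₁₀ᵀ * Λ₁ * Q₁₁ h + Q₁₀ᵀ * Λ₁ * Q₁₁ h) + ((Q₁₀ᵀ * Λ₁ * Q₁₀) * X + -(Xᵀ * (Q₁₀ᵀ * Λ₁ * Q₁₀))) + ((Q₁₀ᵀ * Λ₁ * Q₁₀) * X + -(Xᵀ * (Q₁₀ᵀ * Λ₁ * Q₁₀))))) (fromRows 𝔔'₂ (0 : Matrix (Res (ctr (3 + 1) Lc) Lc M' ⊕ Res (ctr (3 + 1) Lc) Lc (fine Lc M')) (↥(pbox (fine Lc M')) × Fin (3 + 1)) ℝ)))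
      = secondVar (kkt H₀ (fromRows Q₁₀ τ₁)) (fromBlocks H₁ (-Bᵀ) B 0)
            (kkt H₂ (fromRows (Q₁₂ h h) (0 : Matrix (Res (ctr (3 + 1) Lc) Lc (fine Lc M')) (↥(pbox (fine Lc M')) × Fin (3 + 1)) ℝ)))
        + secondVar
            (kkt S.toBlocks₁₁ (fromRows Q₂₀ τ₂))
            (fromBlocks (((L * H₁ - S * B) * I + L * Bᵀ * S).toBlocks₁₁ + Λ₁) (-(fromRows (Q₂₁ h) (0 : Matrix (Res (ctr (3 + 1) Lc) Lc M') (↥(pbox M') × Fin (3 + 1)) ℝ))ᵀ)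
              (fromRows (Q₂₁ h) (0 : Matrix (Res (ctr (3 + 1) Lc) Lc M') (↥(pbox M') × Fin (3 + 1)) ℝ)) 0)
            (kkt ((((-((L * H₁ - S * B) * Γ - L * Bᵀ * L) * H₁ + L * H₂
                      - (((L * H₁ - S * B) * I + L * Bᵀ * S) * B
                          + S * fromRows (Q₁₂ h h) (0 : Matrix (Res (ctr (3 + 1) Lc) Lc (fine Lc M')) (↥(pbox (fine Lc M')) × Fin (3 + 1)) ℝ))) * I
                    + (L * H₁ - S * B) * (-((Γ * H₁ + I * B) * I + Γ * Bᵀ * S)))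
                  - ((-((L * H₁ - S * B) * Γ - L * Bᵀ * L) * (-Bᵀ)
                        + L * (fromRows (Q₁₂ h h) (0 : Matrix (Res (ctr (3 + 1) Lc) Lc (fine Lc M')) (↥(pbox (fine Lc M')) × Fin (3 + 1)) ℝ))ᵀ) * S
                      + L * (-Bᵀ) * ((L * H₁ - S * B) * I + L * Bᵀ * S))).toBlocks₁₁ + Λ₂)
              (fromRows (Q₂₂ h h) (0 : Matrix (Res (ctr (3 + 1) Lc) Lc M') (↥(pbox M') × Fin (3 + 1)) ℝ))) := by
  subst hH₁ hH'₁
  -- the pinned generator is DIAGONAL, hence symmetric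
  have hXt : Xᵀ = X := by rw [hX, Matrix.transpose_neg, Matrix.transpose_smul, Matrix.diagonal_transpose]
  -- the form block of `𝕄_{j+1}` on (ff) IS the rooted candidate's at the centred root ((β-b) §0)
  have hH₀' := hH₀.trans (perF_bhKStepSh_Dsh_ff_eq_perF_bhKStepAt (fine Lc M') (j + 1))
  have hw : wVH 3 Lc (j + 1) ≠ 0 := by
    have hL0 : (0 : ℝ) < Lc := by exact_mod_cast Nat.pos_of_ne_zero (NeZero.ne Lc)
    unfold wVH
    positivity
  have hc : (-2 * (((Lc : ℝ) ^ (3 + 1) * stepScale 3 Lc (j + 1))⁻¹) * wVH 3 Lc (j + 1)) / (2 * wVH 3 Lc (j + 1)) = -(((Lc : ℝ) ^ (3 + 1) * stepScale 3 Lc (j + 1))⁻¹) := by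
    rw [div_eq_iff (mul_ne_zero two_ne_zero hw)]
    ring
  -- an2's two periodised index laws along the pure gauge `Dλ`: form slot (contact = the `k1` similarity shape) and Λ sector (ZERO)
  have hT := torus_formSlot_indexLaw_bhKStepAt (F := fine Lc M') hLc N cΛ cB j (toSite (ctrOff (3 + 1) Lc)) (-2 * (((Lc : ℝ) ^ (3 + 1) * stepScale 3 Lc (j + 1))⁻¹) * wVH 3 Lc (j + 1)) lam
  have hLam := torus_Lam_indexLaw_lamCoeffK_fine (M' := M') (j + 1) w lam
  -- linearity of the two families in the direction
  have hsT : (∑ b : ↥(pbox (fine Lc M')) × Fin (3 + 1), (h b + ∑ s : ↥(pbox (fine Lc M')), tgrad (fine Lc M') (b.1, Sum.inl b.2) s * lam s) •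
        ((-2 * (((Lc : ℝ) ^ (3 + 1) * stepScale 3 Lc (j + 1))⁻¹) * wVH 3 Lc (j + 1)) • (perF (fine Lc M') (dper (fine Lc M')
            (e3OfK Lc (GcombSh (d := 3) Lc j) (JsB12CombSh0 hLc N (symTablesAn1S2 3 Lc cΛ) cΛ cB j).S b.2 (b.1 : Site 4)))).submatrix
          (fun b : ↥(pbox (fine Lc M')) × Fin (3 + 1) => ((b.1, Sum.inl b.2) : Idx (fine Lc M') (Fib 3)))
          (fun b : ↥(pbox (fine Lc M')) × Fin (3 + 1) => ((b.1, Sum.inl b.2) : Idx (fine Lc M') (Fib 3)))))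
      = (∑ b : ↥(pbox (fine Lc M')) × Fin (3 + 1), h b •
        ((-2 * (((Lc : ℝ) ^ (3 + 1) * stepScale 3 Lc (j + 1))⁻¹) * wVH 3 Lc (j + 1)) • (perF (fine Lc M') (dper (fine Lc M')
            (e3OfK Lc (GcombSh (d := 3) Lc j) (JsB12CombSh0 hLc N (symTablesAn1S2 3 Lc cΛ) cΛ cB j).S b.2 (b.1 : Site 4)))).submatrix
          (fun b : ↥(pbox (fine Lc M')) × Fin (3 + 1) => ((b.1, Sum.inl b.2) : Idx (fine Lc M') (Fib 3)))
          (fun b : ↥(pbox (fine Lc M')) × Fin (3 + 1) => ((b.1, Sum.inl b.2) : Idx (fine Lc M') (Fib 3)))))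
        + ∑ b : ↥(pbox (fine Lc M')) × Fin (3 + 1), (∑ s : ↥(pbox (fine Lc M')), tgrad (fine Lc M') (b.1, Sum.inl b.2) s * lam s) •
        ((-2 * (((Lc : ℝ) ^ (3 + 1) * stepScale 3 Lc (j + 1))⁻¹) * wVH 3 Lc (j + 1)) • (perF (fine Lc M') (dper (fine Lc M')
            (e3OfK Lc (GcombSh (d := 3) Lc j) (JsB12CombSh0 hLc N (symTablesAn1S2 3 Lc cΛ) cΛ cB j).S b.2 (b.1 : Site 4)))).submatrix
          (fun b : ↥(pbox (fine Lc M')) × Fin (3 + 1) => ((b.1, Sum.inl b.2) : Idx (fine Lc M') (Fib 3)))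
          (fun b : ↥(pbox (fine Lc M')) × Fin (3 + 1) => ((b.1, Sum.inl b.2) : Idx (fine Lc M') (Fib 3)))) := by
    rw [← Finset.sum_add_distrib]
    exact Finset.sum_congr rfl fun b _ => add_smul _ _ _
  have hsL : (∑ b : ↥(pbox (fine Lc M')) × Fin (3 + 1), (h b + ∑ s : ↥(pbox (fine Lc M')), tgrad (fine Lc M') (b.1, Sum.inl b.2) s * lam s) •
        (w • (perF (fine Lc M') (dper (fine Lc M')
            (SLam Lc (lamCoeffK (KInvStep (d := 3) Lc (j + 1)) (E2 3 Lc (j + 1)) Lc) (symHessFFAt (ctr (3 + 1) Lc) Lc) b.2 (b.1 : Site (3 + 1))))).submatrix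
          (fun b : ↥(pbox (fine Lc M')) × Fin (3 + 1) => ((b.1, Sum.inl b.2) : Idx (fine Lc M') (Fib 3)))
          (fun b : ↥(pbox (fine Lc M')) × Fin (3 + 1) => ((b.1, Sum.inl b.2) : Idx (fine Lc M') (Fib 3)))))
      = (∑ b : ↥(pbox (fine Lc M')) × Fin (3 + 1), h b •
        (w • (perF (fine Lc M') (dper (fine Lc M')
            (SLam Lc (lamCoeffK (KInvStep (d := 3) Lc (j + 1)) (E2 3 Lc (j + 1)) Lc) (symHessFFAt (ctr (3 + 1) Lc) Lc) b.2 (b.1 : Site (3 + 1))))).submatrix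
          (fun b : ↥(pbox (fine Lc M')) × Fin (3 + 1) => ((b.1, Sum.inl b.2) : Idx (fine Lc M') (Fib 3)))
          (fun b : ↥(pbox (fine Lc M')) × Fin (3 + 1) => ((b.1, Sum.inl b.2) : Idx (fine Lc M') (Fib 3)))))
        + ∑ b : ↥(pbox (fine Lc M')) × Fin (3 + 1), (∑ s : ↥(pbox (fine Lc M')), tgrad (fine Lc M') (b.1, Sum.inl b.2) s * lam s) •
        (w • (perF (fine Lc M') (dper (fine Lc M')
            (SLam Lc (lamCoeffK (KInvStep (d := 3) Lc (j + 1)) (E2 3 Lc (j + 1)) Lc) (symHessFFAt (ctr (3 + 1) Lc) Lc) b.2 (b.1 : Site (3 + 1))))).submatrix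
          (fun b : ↥(pbox (fine Lc M')) × Fin (3 + 1) => ((b.1, Sum.inl b.2) : Idx (fine Lc M') (Fib 3)))
          (fun b : ↥(pbox (fine Lc M')) × Fin (3 + 1) => ((b.1, Sum.inl b.2) : Idx (fine Lc M') (Fib 3)))) := by
    rw [← Finset.sum_add_distrib]
    exact Finset.sum_congr rfl fun b _ => add_smul _ _ _
  exact secondVar_oneShot_nestedStepLaw_torus_transported_graded_rows_gen_sym_uLow_closed_companion M' hM' (j + 1) pμ' mμ' hfμ' hcoarse' hH₀ hQ₁₀ hτ₁
    hτ₂ hD₁ hD₂ hDbar hP _ H₂ Λ₁ Λ₂ hΛ₁t hΛ₂t hQ₂₀ h lam Q₁₁ hQ₁₁ Q₂₁ hQ₂₁ hW₁ hDb₁ hdead (Q₁₂ h h) (Q₂₂ h h) hW₂ _ Y₁ Y₂ hX hXbar hW'₁ hW'₂ hC₁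
    h𝔔₀ h𝔔₁ h𝔔₂ h𝔔'₁
    -- `k1` BY TERM: form-slot half by an2's (C) at the weight `wT` (similarity shape one level up), Λ half by an2's (B) (index law ZERO)
    (by
      rw [hXt, ← Matrix.neg_mul, hsT, hsL, hT, hLam, add_zero, hc, hH₀', hX]
      simp only [Matrix.mul_neg, neg_neg, Matrix.smul_mul, Matrix.mul_smul, smul_sub, neg_smul]
      abel)
    k2
    -- `q2` BY TERM (♭ at `j+1`), then the naming; `t2` BY TERM (leaf-06 at `j+1`)
    ((torus_q2_sym_letter_pure M' hM' (j + 1) h lam pμ' mμ' hQ₁₀ hQ₂₀ Q₁₁ hQ₁₁ Q₂₁ hQ₂₁ hW₁₂ Q₁₂ hQ₁₂ hW₂₂ Q₂₂ hQ₂₂ hX hXbar h𝔔₀ h𝔔₁ h𝔔₂).trans h𝔔'₂)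
    (torus_t2_sym_of_average_dead M' (j + 1) h hQ₁₀ Q₁₁ hQ₁₁ hW₁₂ Q₁₂ hQ₁₂ hW₁ hW₂ hD₁ hD₂ hτ₂ hdead)
    -- `hH₁t` BY TERM: form half by an2 (C) §4 `torus_formSlot_family_transpose`, Λ half by (B) `torus_Lam_family_transpose_fine`
    (by
      rw [Matrix.transpose_add, Matrix.transpose_sum, Matrix.transpose_sum, neg_add, ← Finset.sum_neg_distrib, ← Finset.sum_neg_distrib]
      exact congrArg₂ (· + ·)
        (Finset.sum_congr rfl fun b _ => by rw [Matrix.transpose_smul, torus_formSlot_family_transpose, smul_neg])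
        (Finset.sum_congr rfl fun b _ => by rw [Matrix.transpose_smul, torus_Lam_family_transpose_fine, smul_neg]))
    hH₂t a1 a2
    -- `c2` BY TERM (T3 at `j+1`), `d2` BY TERM (#35 at `j+1`)
    (torus_c2_sym_weighted M' (j + 1) h hQ₁₀ Q₁₁ hQ₁₁ hW₁₂ Q₁₂ hQ₁₂ hW₁ hW₂ hD₁ hD₂)
    (torus_d2_sym_bimember M' hM' (j + 1) pμ' mμ' h Q₁₀ Q₁₁ hQ₂₀ Q₂₁ hQ₂₁ hW₂₂ Q₂₂ hQ₂₂ hDbar hDb₁ rfl)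
    hΓ hI hL hS hB

end Summit.QuantumFields.BalabanUV.Beta.FP.NestedStepLawTorusLevelSuccDoorCompanion

end
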